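import Mathlib
import Summits.Ventures.PercRepro2.Defs
import Summits.Ventures.PercRepro2.Independence
import Summits.Ventures.PercRepro2.Harris
import Summits.Ventures.PercRepro2.Graph
import Summits.Ventures.PercRepro2.OneEdge
import Summits.Ventures.PercRepro2.XWForm

/-!
# The (XW) form across the `s–y` edge: the exact concavity defect in the `Q`-world
(PercRepro2, p2 g26)

`XW(p) = xwBil p p = P(aλ) + P(Sa)P(Sλ) − P(a)P(λ) − P(S)P(Saλ)` with `a = {s ↔ u}`,
`λ = {y ↔ o}`, `S = {s ↔ y}`, `Q = Sᶜ` (XWForm.lean).  Let `e` be an edge with ends `{s, y}`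
and `t = p e`.  Forcing `e` open makes `S` sure, so `XW(p[e↦1]) = 0` (`xwBil_update_one_eq_zero`),
and the one-edge Bernstein expansion `xxwBil_bernstein` collapses to the **exact identity**

  `XW(p) = (1 − t)·XW(p[e↦0]) + t(1 − t)·D_sy(p[e↦0])`      (`xwBil_eq_sy_edge`),

where the concavity defect `D_sy` (`dSY`) lives entirely in the `Q`-world of the graph with `e`
closed: with `U = {u ↔ s} ∪ {u ↔ y}` and `O = {o ↔ y} ∪ {o ↔ s}` (the connections of `u`, `o`
to the pair `{s, y}`),

  `D_sy = P(Q)·P(Q ∩ U ∩ O) − P(Q ∩ a)·P(Q ∩ {s ↔ o}) − P(Q ∩ λ)·P(Q ∩ U)`.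

The mechanism: under `p[e↦1]` the event `{x ↔ z}` is the event `{x ↔ z} ∪ ({x ↔ s} ∩ {y ↔ z}) ∪
({x ↔ y} ∩ {s ↔ z})` of `p[e↦0]` (`OneEdge.conn_update_true_iff`, through the forcing identity
`prob_update_one_eq_preimage'`), so the three forms `B(p₀, p₁)`, `B(p₁, p₀)`, `B(p₁, p₁)` are
`p₀`-probabilities of `U`, `O`, `U ∩ O`; on `S` these are `Sa`, `Sλ`, `Saλ` and on `Q` the two
halves of `O` are disjoint (`o` cannot reach both `s` and `y` when `s ↮ y`).  Consequences:

* `xwBil_nonneg_of_dSY_nonneg` — **the edge-removal reduction**: if `0 ≤ D_sy` (the conjecture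
  (C-sy) of record P2-G25-XWSTRUCT.md §9, «XW is concave in `p_sy`») and (XW) holds with `e`
  closed, then (XW) holds at `p`; so (C-sy) makes the `s–y` edge removable without loss.
* `dSY_eq_cov_form` — `D_sy = [P(Q)P(QUO) − P(QU)P(QO)] + P(Q ∩ {u ↔ y})·P(Q ∩ {o ↔ s})`: the
  `Q`-covariance of the union events plus the cross product, the form in which (C-sy) reads
  `Cov_Q(U, O) ≥ −P_Q(u ∈ C_y)·P_Q(o ∈ C_s)`.

Own work; standard axioms.
-/

namespace Summit.Ventures.PercRepro2

namespace XWEdgeSY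

variable {V : Type*} {E : Type*} [Fintype E] [DecidableEq E] {R : Type*} [CommRing R]

/-! ## The forcing identity for probabilities (the `R`-valued `prob` of Defs.lean) -/

/-- `P_{p[e↦1]}(A) = P_p({ω | ω[e ↦ open] ∈ A})`. -/
lemma prob_update_one_eq_preimage' (p : E → R) (e : E) (A : Set (Config E)) :
    prob (Function.update p e 1) A = prob p {ω | Function.update ω e true ∈ A} := by
  rw [prob_eq_expect_indicator, prob_eq_expect_indicator, expect_update_one]
  refine congrArg _ (funext fun ω => ?_)
  by_cases h : Function.update ω e true ∈ A
  · simp [h]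
  · simp [h]

/-- `P_{p[e↦1]}(A) = P_{p[e↦0]}({ω | ω[e ↦ open] ∈ A})`. -/
lemma prob_update_one_eq_update_zero_preimage (p : E → R) (e : E) (A : Set (Config E)) :
    prob (Function.update p e 1) A =
      prob (Function.update p e 0) {ω | Function.update ω e true ∈ A} := by
  rw [← prob_update_one_eq_preimage' (Function.update p e 0) e A, Function.update_idem]

/-! ## The events of `p[e↦1]` seen from `p[e↦0]` -/

variable (ends : E → Sym2 V) (s y o u : V)

/-- `U = {s ↔ u} ∪ {y ↔ u}`: `u` is connected to the pair `{s, y}`. -/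
def U : Set (Config E) := connEvent ends s u ∪ connEvent ends y u

/-- `O = {y ↔ o} ∪ {s ↔ o}`: `o` is connected to the pair `{s, y}`. -/
def O : Set (Config E) := connEvent ends y o ∪ connEvent ends s o

variable {ends s y}

omit [Fintype E] in
/-- With `e = {s, y}` forced open, `{s ↔ y}` is sure. -/
lemma preimage_S {e : E} (he : ends e = s(s, y)) :
    {ω : Config E | Function.update ω e true ∈ connEvent ends s y} = Set.univ := by
  ext ω
  simp only [Set.mem_setOf_eq, mem_connEvent, Set.mem_univ, iff_true]
  rw [OneEdge.conn_update_true_iff he]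
  exact Or.inr (Or.inl ⟨conn_refl ends ω s, conn_refl ends ω y⟩)

omit [Fintype E] in
/-- With `e = {s, y}` forced open, `{s ↔ u}` is `U`. -/
lemma preimage_a {e : E} (he : ends e = s(s, y)) :
    {ω : Config E | Function.update ω e true ∈ connEvent ends s u} = U ends s y u := by
  ext ω
  simp only [Set.mem_setOf_eq, mem_connEvent, U, Set.mem_union]
  rw [OneEdge.conn_update_true_iff he]
  constructor
  · rintro (h | ⟨_, h⟩ | ⟨_, h⟩)
    · exact Or.inl h
    · exact Or.inr h
    · exact Or.inl h
  · rintro (h | h)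
    · exact Or.inl h
    · exact Or.inr (Or.inl ⟨conn_refl ends ω s, h⟩)

omit [Fintype E] in
/-- With `e = {s, y}` forced open, `{y ↔ o}` is `O`. -/
lemma preimage_l {e : E} (he : ends e = s(s, y)) :
    {ω : Config E | Function.update ω e true ∈ connEvent ends y o} = O ends s y o := by
  ext ω
  simp only [Set.mem_setOf_eq, mem_connEvent, O, Set.mem_union]
  rw [OneEdge.conn_update_true_iff he]
  constructor
  · rintro (h | ⟨_, h⟩ | ⟨_, h⟩)
    · exact Or.inl h
    · exact Or.inl h
    · exact Or.inr h
  · rintro (h | h)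
    · exact Or.inl h
    · exact Or.inr (Or.inr ⟨conn_refl ends ω y, h⟩)

omit [Fintype E] in
/-- Preimages of intersections. -/
lemma preimage_inter (e : E) (A B : Set (Config E)) :
    {ω : Config E | Function.update ω e true ∈ A ∩ B} =
      {ω | Function.update ω e true ∈ A} ∩ {ω | Function.update ω e true ∈ B} := rfl

/-! ## The three pinned forms -/

variable (ends s y) in
/-- `B(p₁, p₁) = 0`: with `e = {s, y}` forced open, `S` is sure and the form collapses. -/
theorem xwBil_update_one_eq_zero (p : E → R) {e : E} (he : ends e = s(s, y)) :
    xwBil ends s y o u (Function.update p e 1) (Function.update p e 1) = 0 := by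
  unfold xwBil
  simp only [prob_update_one_eq_update_zero_preimage p e, preimage_inter, preimage_S he,
    preimage_a (u := u) he, preimage_l (o := o) he, Set.univ_inter, prob_univ]
  ring

omit [Fintype E] [DecidableEq E] in
/-- On `S`, `U` is `S ∩ a`. -/
lemma S_inter_U : connEvent ends s y ∩ U ends s y u = connEvent ends s y ∩ connEvent ends s u := by
  ext ω
  simp only [U, Set.mem_inter_iff, Set.mem_union, mem_connEvent]
  constructor
  · rintro ⟨hS, h | h⟩
    · exact ⟨hS, h⟩
    · exact ⟨hS, conn_trans hS h⟩
  · rintro ⟨hS, h⟩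
    exact ⟨hS, Or.inl h⟩

omit [Fintype E] [DecidableEq E] in
/-- On `S`, `O` is `S ∩ λ`. -/
lemma S_inter_O : connEvent ends s y ∩ O ends s y o = connEvent ends s y ∩ connEvent ends y o := by
  ext ω
  simp only [O, Set.mem_inter_iff, Set.mem_union, mem_connEvent]
  constructor
  · rintro ⟨hS, h | h⟩
    · exact ⟨hS, h⟩
    · exact ⟨hS, conn_trans (conn_symm hS) h⟩
  · rintro ⟨hS, h⟩
    exact ⟨hS, Or.inl h⟩

omit [Fintype E] [DecidableEq E] in
/-- On `S`, `U ∩ O` is `S ∩ a ∩ λ`. -/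
lemma S_inter_U_inter_O :
    connEvent ends s y ∩ (U ends s y u ∩ O ends s y o) =
      connEvent ends s y ∩ connEvent ends s u ∩ connEvent ends y o := by
  rw [← Set.inter_assoc, S_inter_U, Set.inter_assoc, Set.inter_comm (connEvent ends s u),
    ← Set.inter_assoc, S_inter_O, Set.inter_assoc, Set.inter_comm (connEvent ends y o),
    ← Set.inter_assoc]

omit [Fintype E] [DecidableEq E] in
/-- On `Q`, the two halves of `O` are disjoint: `o` cannot reach both `s` and `y`. -/
lemma Q_inter_O_eq :
    (connEvent ends s y)ᶜ ∩ O ends s y o =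
      (connEvent ends s y)ᶜ ∩ connEvent ends y o ∪
        (connEvent ends s y)ᶜ ∩ connEvent ends s o := by
  simp only [O, Set.inter_union_distrib_left]

omit [Fintype E] [DecidableEq E] in
/-- On `Q`, the two halves of `O` are disjoint (as sets). -/
lemma Q_inter_O_disjoint :
    Disjoint ((connEvent ends s y)ᶜ ∩ connEvent ends y o)
      ((connEvent ends s y)ᶜ ∩ connEvent ends s o) := by
  rw [Set.disjoint_left]
  rintro ω ⟨hQ, hyo⟩ ⟨_, hso⟩
  exact hQ (conn_trans hso (conn_symm hyo))

/-! ## The defect and the identity -/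

variable (ends s y) in
/-- **The `s–y` concavity defect** in the `Q`-world:
`D_sy = P(Q)·P(Q ∩ U ∩ O) − P(Q ∩ a)·P(Q ∩ {s ↔ o}) − P(Q ∩ λ)·P(Q ∩ U)`. -/
noncomputable def dSY (p : E → R) : R :=
  prob p (connEvent ends s y)ᶜ * prob p ((connEvent ends s y)ᶜ ∩ (U ends s y u ∩ O ends s y o)) -
    prob p ((connEvent ends s y)ᶜ ∩ connEvent ends s u) *
      prob p ((connEvent ends s y)ᶜ ∩ connEvent ends s o) -
    prob p ((connEvent ends s y)ᶜ ∩ connEvent ends y o) *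
      prob p ((connEvent ends s y)ᶜ ∩ U ends s y u)

variable (ends s y) in
/-- **The mixed coefficients**: `B(p₀, p₁) + B(p₁, p₀) = XW(p₀) + D_sy(p₀)` for `e = {s, y}`. -/
theorem xwBil_mixed_eq (p : E → R) {e : E} (he : ends e = s(s, y)) :
    xwBil ends s y o u (Function.update p e 0) (Function.update p e 1) +
        xwBil ends s y o u (Function.update p e 1) (Function.update p e 0) =
      xwBil ends s y o u (Function.update p e 0) (Function.update p e 0) +
        dSY ends s y o u (Function.update p e 0) := by
  unfold xwBil dSY
  simp only [prob_update_one_eq_update_zero_preimage p e, preimage_inter, preimage_S he,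
    preimage_a (u := u) he, preimage_l (o := o) he, Set.univ_inter, prob_univ]
  set q := Function.update p e 0 with hq
  set S := connEvent ends s y with hS
  set a := connEvent ends s u with ha
  set l := connEvent ends y o with hl
  set h := connEvent ends s o with hh
  set Uu := U ends s y u with hU
  set Oo := O ends s y o with hO
  -- the `S/Q` splits
  have e1 : prob q Uu = prob q (S ∩ a) + prob q (Sᶜ ∩ Uu) := by
    rw [← prob_inter_add_prob_inter_compl q Uu S, Set.inter_comm Uu S, S_inter_U,
      Set.inter_comm Uu Sᶜ]
  have e2 : prob q Oo = prob q (S ∩ l) + (prob q (Sᶜ ∩ l) + prob q (Sᶜ ∩ h)) := by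
    rw [← prob_inter_add_prob_inter_compl q Oo S, Set.inter_comm Oo S, S_inter_O,
      Set.inter_comm Oo Sᶜ, Q_inter_O_eq, prob_union_of_disjoint q (Q_inter_O_disjoint o)]
  have e3 : prob q (Uu ∩ Oo) = prob q (S ∩ a ∩ l) + prob q (Sᶜ ∩ (Uu ∩ Oo)) := by
    rw [← prob_inter_add_prob_inter_compl q (Uu ∩ Oo) S, Set.inter_comm (Uu ∩ Oo) S,
      S_inter_U_inter_O, Set.inter_comm (Uu ∩ Oo) Sᶜ]
  have e4 : prob q a = prob q (S ∩ a) + prob q (Sᶜ ∩ a) := by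
    rw [← prob_inter_add_prob_inter_compl q a S, Set.inter_comm a S, Set.inter_comm a Sᶜ]
  have e5 : prob q l = prob q (S ∩ l) + prob q (Sᶜ ∩ l) := by
    rw [← prob_inter_add_prob_inter_compl q l S, Set.inter_comm l S, Set.inter_comm l Sᶜ]
  have e6 : prob q S = 1 - prob q Sᶜ := by rw [prob_compl, sub_sub_cancel]
  rw [e1, e2, e3, e4, e5, e6]
  ring

variable (ends s y) in
/-- **The exact `s–y` edge identity**:
`XW(p) = (1 − p e)·XW(p[e↦0]) + p e·(1 − p e)·D_sy(p[e↦0])` for an edge `e = {s, y}`. -/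
theorem xwBil_eq_sy_edge (p : E → R) {e : E} (he : ends e = s(s, y)) :
    xwBil ends s y o u p p =
      (1 - p e) * xwBil ends s y o u (Function.update p e 0) (Function.update p e 0) +
        p e * (1 - p e) * dSY ends s y o u (Function.update p e 0) := by
  have hB := xxwBil_bernstein ends s y o u p p e
  have h11 := xwBil_update_one_eq_zero (o := o) (u := u) ends s y p he
  have hmix := xwBil_mixed_eq ends s y o u p he
  rw [hB, h11]
  linear_combination (p e * (1 - p e)) * hmix

variable (ends s y) in
/-- **The edge-removal reduction**: if the defect is nonnegative ((C-sy) at `p[e↦0]`) and (XW)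
holds with `e` closed, then (XW) holds at `p`. -/
theorem xwBil_nonneg_of_dSY_nonneg [LinearOrder R] [IsStrictOrderedRing R] {p : E → R}
    (hp : IsProbVec p) {e : E} (he : ends e = s(s, y))
    (hD : 0 ≤ dSY ends s y o u (Function.update p e 0))
    (h0 : 0 ≤ xwBil ends s y o u (Function.update p e 0) (Function.update p e 0)) :
    0 ≤ xwBil ends s y o u p p := by
  rw [xwBil_eq_sy_edge ends s y o u p he]
  have h1 : 0 ≤ 1 - p e := by linarith [hp.le_one e]
  have h2 : 0 ≤ p e := hp.nonneg e
  positivity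

variable (ends s y) in
/-- **The covariance form of the defect**:
`D_sy = [P(Q)P(Q ∩ U ∩ O) − P(Q ∩ U)P(Q ∩ O)] + P(Q ∩ {y ↔ u})·P(Q ∩ {s ↔ o})`. -/
theorem dSY_eq_cov_form (p : E → R) :
    dSY ends s y o u p =
      (prob p (connEvent ends s y)ᶜ * prob p ((connEvent ends s y)ᶜ ∩ (U ends s y u ∩ O ends s y o)) -
          prob p ((connEvent ends s y)ᶜ ∩ U ends s y u) *
            prob p ((connEvent ends s y)ᶜ ∩ O ends s y o)) +
        prob p ((connEvent ends s y)ᶜ ∩ connEvent ends y u) *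
          prob p ((connEvent ends s y)ᶜ ∩ connEvent ends s o) := by
  unfold dSY
  have hO : prob p ((connEvent ends s y)ᶜ ∩ O ends s y o) =
      prob p ((connEvent ends s y)ᶜ ∩ connEvent ends y o) +
        prob p ((connEvent ends s y)ᶜ ∩ connEvent ends s o) := by
    rw [Q_inter_O_eq, prob_union_of_disjoint p (Q_inter_O_disjoint o)]
  have hU : prob p ((connEvent ends s y)ᶜ ∩ U ends s y u) =
      prob p ((connEvent ends s y)ᶜ ∩ connEvent ends s u) +
        prob p ((connEvent ends s y)ᶜ ∩ connEvent ends y u) := by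
    have e : (connEvent ends s y)ᶜ ∩ U ends s y u =
        (connEvent ends s y)ᶜ ∩ connEvent ends s u ∪
          (connEvent ends s y)ᶜ ∩ connEvent ends y u := by
      simp only [U, Set.inter_union_distrib_left]
    have d : Disjoint ((connEvent ends s y)ᶜ ∩ connEvent ends s u)
        ((connEvent ends s y)ᶜ ∩ connEvent ends y u) := by
      rw [Set.disjoint_left]
      rintro ω ⟨hQ, hsu⟩ ⟨_, hyu⟩
      exact hQ (conn_trans hsu (conn_symm hyu))
    rw [e, prob_union_of_disjoint p d]
  rw [hO, hU]
  ring

end XWEdgeSY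

end Summit.Ventures.PercRepro2
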